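import Summits.Schanuel.Schanuel.Theorems.ZilberEacCancellingFibreLimits
import Summits.Schanuel.Schanuel.Theorems.ZilberEacDiagonalCriticalExistence
import HarnessLib

/-!
# The cancelling-fibre regime: implicit-function continuation (existence of solutions)

Zilber's Exponential-Algebraic Closedness, case ladder (host summit Schanuel, cell `pub-schanuel`,
seat 2, gen 15).  THE FAMILY (`e₀ ≥ 1`, coefficient sequences `A₀, A₁ : ℕ → ℂ` — the fibre
polynomials `F₀(u) = Σ_{i<e₀} A_{0,i}uⁱ` with `a₀ = A_{0,e₀-1} ≠ 0` and `F₁(u) = Σ_{i<e₁} A_{1,i}uⁱ` —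
`r₀ ≠ 0`, `r₁ ∈ ℝ`, `c ∈ ℂ`):

  `W = {x₂ = r₀x₀ + r₁x₁ + c,  y₀ = x₀ + y₂F₀(y₂),  y₁ = x₁ + y₂F₁(y₂)} ⊆ ℂ³ × ℂ³`,

exponential points `e^{xⱼ} = xⱼ + y₂Fⱼ(y₂)`, `y₂ = e^{x₂}`.  THE CANCELLING-FIBRE REGIME (new; it
covers the SUPER-CRITICAL sizes left open as O57/O58 (a) in the cell's census, where no relatively
small perturbation of lattice centres exists): a growth exponent `β > 0` with `βe₁ < e₀` and
`(β/e₀ - r₁)/r₀ < β`; TWO independent labels, `m → ∞` and `k' = ⌊r₁m - m^β⌋`, `K = r₁m - k'`;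

  `x₁ = Log(2πim) + 2πim + u₁`                      (slow fibre: `e^{x₁} ≈ x₁`),
  `x₂ = 2πik' + (τ + u₂)/e₀`, `τ = Log(2πiK/(r₀a₀))`  (so `r₀a₀y₂^{e₀} = 2πiK e^{u₂}`),
  `x₀ = (x₂ - r₁x₁ - c)/r₀ ≈ -y₂F₀(y₂)`              (CANCELLING fibre: `e^{x₀} = o(y₂F₀(y₂))`).

Dividing the fibre equations by `2πiK` and `2πim` gives an ENTIRE system in `(u₁, u₂)` and the
seven small parameters `σ, μ, ν, η, μ₁, ν₁, θ` of `ZilberEacCancellingFibreLimits`, whose value at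
parameter `0` is `(e^{u₂} - 1, e^{u₁} - 1)` with the invertible Jacobian `(w₁, w₂) ↦ (w₂, w₁)` at
`u = 0`; the implicit function theorem (`exists_implicit_of_injective_partial`) continues `u = 0` to
honest solutions with `u(m) → 0`.  **`exists_solutions_cancellingFibre`** exports the labels, the
shape of the solutions and the two fibre equations; the growth rates
(`|x₁| ≍ m`, `|y₂| ≍ m^{β/e₀}`, `|y₀| ≍ m^{(β/e₀ - r₁)/r₀}`) and Zariski density are derived in
`ZilberEacCancellingFibreDensity`.

HONEST FRAMING: an existence theorem for explicit members of an OPEN cell (`ECCell 3 2`);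
NOT Schanuel's conjecture; EAC ⇏ SC.
-/

noncomputable section

open Complex Filter Topology

set_option linter.dupNamespace false

namespace Summit.Schanuel.Schanuel.Theorems

section Cancelling

/-- `S^{i+1} = S^e σ^{e-1-i}` for `Sσ = 1`, `i < e`. [folklore] -/
theorem pow_succ_eq_pow_mul_inv_pow {S σ : ℂ} (h : S * σ = 1) {e i : ℕ} (hi : i < e) :
    S ^ (i + 1) = S ^ e * σ ^ (e - 1 - i) := by
  have he : (i + 1) + (e - 1 - i) = e := by omega
  calc S ^ (i + 1) = S ^ (i + 1) * (S * σ) ^ (e - 1 - i) := by rw [h, one_pow, mul_one]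
    _ = S ^ e * σ ^ (e - 1 - i) := by rw [mul_pow, ← mul_assoc, ← pow_add, he]

/-- **THEOREM (solutions in the cancelling-fibre regime).**  See the module docstring. (new)
[cite: MantovaMasser2023, §1 p.5 (the open case dim π(V) = 2 in ℂ³×ℂˣ³)] -/
theorem exists_solutions_cancellingFibre (e₀ : ℕ) (he₀ : 1 ≤ e₀) (e₁ : ℕ) (A : Fin 2 → ℕ → ℂ)
    (ha₀ : A 0 (e₀ - 1) ≠ 0) (r₀ r₁ : ℝ) (hr₀ : r₀ ≠ 0) (c : ℂ) {β : ℝ} (hβ : 0 < β)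
    (hβ₁ : β * e₁ < e₀) (hγ : (β / e₀ - r₁) / r₀ < β) :
    ∃ (K : ℕ → ℝ) (n : ℕ → ℤ) (x : ℕ → Fin 2 → ℂ) (u : ℕ → ℂ × ℂ),
      (∀ m : ℕ, (m : ℝ) ^ β ≤ K m ∧ K m ≤ (m : ℝ) ^ β + 1) ∧
      Tendsto u atTop (𝓝 0) ∧
      (∀ m, x m 1 = Complex.log (2 * Real.pi * I * (m : ℂ)) + 2 * Real.pi * I * (m : ℂ) + (u m).1) ∧
      (∀ m, ∑ i, ((![r₀, r₁] : Fin 2 → ℝ) i : ℂ) * x m i + c =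
        2 * Real.pi * I * (n m : ℂ) +
          (Complex.log (2 * Real.pi * I * (K m : ℂ) / ((r₀ : ℂ) * A 0 (e₀ - 1))) + (u m).2) /
            (e₀ : ℂ)) ∧
      (∀ m, x m 0 = ((∑ i, ((![r₀, r₁] : Fin 2 → ℝ) i : ℂ) * x m i + c) - (r₁ : ℂ) * x m 1 - c) /
        (r₀ : ℂ)) ∧
      ∀ᶠ m in atTop,
        exp (x m 0) = x m 0 + exp (∑ i, ((![r₀, r₁] : Fin 2 → ℝ) i : ℂ) * x m i + c) *
            ∑ i ∈ Finset.range e₀, A 0 i *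
              (exp (∑ i, ((![r₀, r₁] : Fin 2 → ℝ) i : ℂ) * x m i + c)) ^ i ∧
        exp (x m 1) = x m 1 + exp (∑ i, ((![r₀, r₁] : Fin 2 → ℝ) i : ℂ) * x m i + c) *
            ∑ i ∈ Finset.range e₁, A 1 i *
              (exp (∑ i, ((![r₀, r₁] : Fin 2 → ℝ) i : ℂ) * x m i + c)) ^ i := by
  -- constants
  have he0 : e₀ ≠ 0 := by omega
  have heC : (e₀ : ℂ) ≠ 0 := by exact_mod_cast he0
  have hr₀C : (r₀ : ℂ) ≠ 0 := by exact_mod_cast hr₀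
  have h2πI : (2 * Real.pi * I : ℂ) ≠ 0 := Complex.two_pi_I_ne_zero
  obtain ⟨a₀, ha₀def⟩ : ∃ a₀ : ℂ, a₀ = A 0 (e₀ - 1) := ⟨_, rfl⟩
  have ha₀0 : a₀ ≠ 0 := by rw [ha₀def]; exact ha₀
  -- the two-scale labels
  obtain ⟨kq, hkq⟩ : ∃ kq : ℕ → ℤ, kq = fun m : ℕ => ⌊r₁ * (m : ℝ) - (m : ℝ) ^ β⌋ := ⟨_, rfl⟩
  obtain ⟨K, hKdef⟩ : ∃ K : ℕ → ℝ, K = fun m => r₁ * m - (kq m : ℝ) := ⟨_, rfl⟩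
  have hK : ∀ m : ℕ, (m : ℝ) ^ β ≤ K m ∧ K m ≤ (m : ℝ) ^ β + 1 := by
    intro m
    have := floorLabel_bounds r₁ β m
    rw [hKdef, hkq]
    exact this
  have hKkq : ∀ m : ℕ, (2 * Real.pi * I * (kq m : ℂ)) = 2 * Real.pi * I * ((r₁ : ℂ) * m) -
      2 * Real.pi * I * (K m : ℂ) := by
    intro m
    rw [hKdef]
    push_cast
    ring
  -- the seven parameters tend to zero
  have hσ := tendsto_param_sigma hβ hK hr₀ ha₀0 e₀ he₀
  have hμ := tendsto_param_mu hβ hK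
  have hν := tendsto_param_nu hβ hK hr₀ ha₀0 e₀ he₀ r₁ c
  have hη := tendsto_param_eta hβ hK hr₀ ha₀0 e₀ he₀ r₁ c hγ
  have hμ₁ := tendsto_param_mu₁
  have hν₁ := tendsto_param_nu₁
  have hθ := tendsto_param_theta hβ hK hr₀ ha₀0 e₀ he₀ e₁ hβ₁
  have hprt := hσ.prodMk_nhds (hμ.prodMk_nhds (hν.prodMk_nhds (hη.prodMk_nhds
    (hμ₁.prodMk_nhds (hν₁.prodMk_nhds hθ)))))
  rw [show (((0 : ℂ), (0 : ℂ), (0 : ℂ), (0 : ℂ), (0 : ℂ), (0 : ℂ), (0 : ℂ)) :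
    ℂ × ℂ × ℂ × ℂ × ℂ × ℂ × ℂ) = 0 from rfl] at hprt
  -- the rescaled system: parameters `(σ, μ, ν, η, μ₁, ν₁, θ)`, unknowns `(u₁, u₂)`
  set f : (ℂ × ℂ × ℂ × ℂ × ℂ × ℂ × ℂ) × (ℂ × ℂ) → ℂ × ℂ := fun w =>
    (exp w.2.2 - 1 + w.1.1 * (∑ i ∈ Finset.range (e₀ - 1), A 0 i / a₀ * w.1.1 ^ (e₀ - 2 - i) *
        exp ((((i : ℕ) : ℂ) + 1) * (w.2.2 / (e₀ : ℂ)))) + w.1.2.2.1 +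
        w.1.2.1 * (w.2.2 / (e₀ : ℂ) - (r₁ : ℂ) * w.2.1) -
        w.1.2.2.2.1 * exp ((w.2.2 / (e₀ : ℂ) - (r₁ : ℂ) * w.2.1) / (r₀ : ℂ)),
      exp w.2.1 - 1 - w.1.2.2.2.2.2.1 - w.1.2.2.2.2.1 * w.2.1 -
        w.1.2.2.2.2.2.2 * ∑ i ∈ Finset.range e₁, A 1 i * w.1.1 ^ (e₁ - 1 - i) *
          exp ((((i : ℕ) : ℂ) + 1) * (w.2.2 / (e₀ : ℂ)))) with hf
  have hfC : ContDiff ℂ 1 f := by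
    rw [hf]
    fun_prop
  have hfq : f (0, 0) = 0 := by
    simp [hf]
  set L : (ℂ × ℂ) →L[ℂ] (ℂ × ℂ) :=
    (ContinuousLinearMap.snd ℂ ℂ ℂ).prod (ContinuousLinearMap.fst ℂ ℂ ℂ) with hL
  have hLderiv : HasFDerivAt (fun q' : ℂ × ℂ => f (0, q')) L 0 := by
    have eqf : (fun q' : ℂ × ℂ => f (0, q')) = fun q' => (exp q'.2 - 1, exp q'.1 - 1) := by
      funext q'
      simp [hf]
    rw [eqf]
    have ha : HasFDerivAt (fun q' : ℂ × ℂ => q'.1) (ContinuousLinearMap.fst ℂ ℂ ℂ) 0 :=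
      hasFDerivAt_fst
    have hb : HasFDerivAt (fun q' : ℂ × ℂ => q'.2) (ContinuousLinearMap.snd ℂ ℂ ℂ) 0 :=
      hasFDerivAt_snd
    refine ((hb.cexp.sub_const 1).prodMk (ha.cexp.sub_const 1)).congr_fderiv ?_
    rw [hL]
    ext <;> simp
  have hinj : Function.Injective L := by
    refine (injective_iff_map_eq_zero _).2 fun w hw => ?_
    rw [hL] at hw
    have hw' : w.2 = 0 ∧ w.1 = 0 := by simpa [Prod.ext_iff] using hw
    exact Prod.ext hw'.2 hw'.1
  -- the implicit function and the solutions
  obtain ⟨ψ, hψsol, hψlim⟩ := exists_implicit_of_injective_partial hfC hfq hLderiv hinj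
  set pr : ℕ → ℂ × ℂ × ℂ × ℂ × ℂ × ℂ × ℂ := fun m =>
    (exp (-(Complex.log (2 * Real.pi * I * (K m : ℂ) / ((r₀ : ℂ) * a₀))) / (e₀ : ℂ)),
      (2 * Real.pi * I * (K m : ℂ))⁻¹,
      (2 * Real.pi * I * (K m : ℂ))⁻¹ *
        (Complex.log (2 * Real.pi * I * (K m : ℂ) / ((r₀ : ℂ) * a₀)) / (e₀ : ℂ) -
          (r₁ : ℂ) * Complex.log (2 * Real.pi * I * (m : ℂ)) - c),
      (r₀ : ℂ) * (2 * Real.pi * I * (K m : ℂ))⁻¹ *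
        exp ((-(2 * Real.pi * I * (K m : ℂ)) +
          Complex.log (2 * Real.pi * I * (K m : ℂ) / ((r₀ : ℂ) * a₀)) / (e₀ : ℂ) -
          (r₁ : ℂ) * Complex.log (2 * Real.pi * I * (m : ℂ)) - c) / (r₀ : ℂ)),
      (2 * Real.pi * I * (m : ℂ))⁻¹,
      (2 * Real.pi * I * (m : ℂ))⁻¹ * Complex.log (2 * Real.pi * I * (m : ℂ)),
      (2 * Real.pi * I * (m : ℂ))⁻¹ *
        exp ((e₁ : ℂ) * Complex.log (2 * Real.pi * I * (K m : ℂ) / ((r₀ : ℂ) * a₀)) / (e₀ : ℂ)))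
    with hpr
  have hprt' : Tendsto pr atTop (𝓝 0) := hprt
  have hulim : Tendsto (fun m => ψ (pr m)) atTop (𝓝 0) := hψlim.comp hprt'
  have hsol : ∀ᶠ m in atTop, f (pr m, ψ (pr m)) = 0 := hprt'.eventually hψsol
  -- the solutions
  set x : ℕ → Fin 2 → ℂ := fun m =>
    ![((2 * Real.pi * I * (kq m : ℂ) +
          (Complex.log (2 * Real.pi * I * (K m : ℂ) / ((r₀ : ℂ) * a₀)) + (ψ (pr m)).2) / (e₀ : ℂ)) -
        (r₁ : ℂ) * (Complex.log (2 * Real.pi * I * (m : ℂ)) + 2 * Real.pi * I * (m : ℂ) +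
          (ψ (pr m)).1) - c) / (r₀ : ℂ),
      Complex.log (2 * Real.pi * I * (m : ℂ)) + 2 * Real.pi * I * (m : ℂ) + (ψ (pr m)).1] with hx
  have hℓ : ∀ m, ∑ i, ((![r₀, r₁] : Fin 2 → ℝ) i : ℂ) * x m i + c =
      2 * Real.pi * I * (kq m : ℂ) +
        (Complex.log (2 * Real.pi * I * (K m : ℂ) / ((r₀ : ℂ) * a₀)) + (ψ (pr m)).2) / (e₀ : ℂ) := by
    intro m
    rw [Fin.sum_univ_two]
    simp only [hx, Matrix.cons_val_zero, Matrix.cons_val_one]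
    field_simp
    ring
  refine ⟨K, kq, x, fun m => ψ (pr m), hK, hulim, fun m => ?_, fun m => ?_, fun m => ?_, ?_⟩
  · simp only [hx, Matrix.cons_val_one, Matrix.cons_val_zero]
  · rw [hℓ, ha₀def]
  · rw [hℓ]
    simp only [hx, Matrix.cons_val_one, Matrix.cons_val_zero]
  filter_upwards [hsol, eventually_ge_atTop 1] with m hm hm1
  -- nonvanishing facts for this `m`
  have hKpos : 0 < K m := by linarith [one_le_of_rpow_le hβ (fun m => (hK m).1) hm1]
  have hKC : (2 * Real.pi * I * (K m : ℂ)) ≠ 0 :=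
    mul_ne_zero h2πI (by exact_mod_cast hKpos.ne')
  have hmC : (m : ℂ) ≠ 0 := by exact_mod_cast (show m ≠ 0 by omega)
  have h2πim : (2 * Real.pi * I * (m : ℂ)) ≠ 0 := mul_ne_zero h2πI hmC
  have hq0 : 2 * Real.pi * I * (K m : ℂ) / ((r₀ : ℂ) * a₀) ≠ 0 :=
    div_ne_zero hKC (mul_ne_zero hr₀C ha₀0)
  -- opaque atoms
  obtain ⟨τ, hτ⟩ : ∃ τ : ℂ, Complex.log (2 * Real.pi * I * (K m : ℂ) / ((r₀ : ℂ) * a₀)) = τ := ⟨_, rfl⟩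
  obtain ⟨Λ, hΛ⟩ : ∃ Λ : ℂ, Complex.log (2 * Real.pi * I * (m : ℂ)) = Λ := ⟨_, rfl⟩
  obtain ⟨u₁, hu₁⟩ : ∃ u₁ : ℂ, (ψ (pr m)).1 = u₁ := ⟨_, rfl⟩
  obtain ⟨u₂, hu₂⟩ : ∃ u₂ : ℂ, (ψ (pr m)).2 = u₂ := ⟨_, rfl⟩
  obtain ⟨S, hS⟩ : ∃ S : ℂ, exp (τ / (e₀ : ℂ)) = S := ⟨_, rfl⟩
  obtain ⟨σ, hσ'⟩ : ∃ σ : ℂ, exp (-τ / (e₀ : ℂ)) = σ := ⟨_, rfl⟩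
  have hSσ : S * σ = 1 := by
    rw [← hS, ← hσ', ← Complex.exp_add, show τ / (e₀ : ℂ) + -τ / (e₀ : ℂ) = 0 by ring,
      Complex.exp_zero]
  have hSe : S ^ e₀ = 2 * Real.pi * I * (K m : ℂ) / ((r₀ : ℂ) * a₀) := by
    rw [← hS, ← Complex.exp_nat_mul, mul_div_cancel₀ _ heC, ← hτ, Complex.exp_log hq0]
  have hK2 : (r₀ : ℂ) * a₀ * S ^ e₀ = 2 * Real.pi * I * (K m : ℂ) := by
    rw [hSe]; field_simp
  have hSe₁ : exp ((e₁ : ℂ) * τ / (e₀ : ℂ)) = S ^ e₁ := by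
    rw [← hS, ← Complex.exp_nat_mul, mul_div_assoc]
  -- `exp(x₂) = S e^{u₂/e₀}` and its powers
  have hexpt : exp (2 * Real.pi * I * (kq m : ℂ) + (τ + u₂) / (e₀ : ℂ)) = S * exp (u₂ / (e₀ : ℂ)) := by
    rw [Complex.exp_add, add_div, Complex.exp_add, hS]
    have : exp (2 * Real.pi * I * (kq m : ℂ)) = 1 := by
      rw [show 2 * Real.pi * I * (kq m : ℂ) = (kq m : ℂ) * (2 * Real.pi * I) by ring]
      exact Complex.exp_int_mul_two_pi_mul_I _
    rw [this, one_mul]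
  have hEpow : ∀ i : ℕ, (S * exp (u₂ / (e₀ : ℂ))) ^ (i + 1) =
      S ^ (i + 1) * exp ((((i : ℕ) : ℂ) + 1) * (u₂ / (e₀ : ℂ))) := by
    intro i
    rw [mul_pow]
    congr 1
    rw [← Complex.exp_nat_mul, Nat.cast_succ]
  -- the fibre sums
  obtain ⟨R₁, hR₁⟩ : ∃ R₁ : ℂ, (∑ i ∈ Finset.range e₁, A 1 i * σ ^ (e₁ - 1 - i) *
    exp ((((i : ℕ) : ℂ) + 1) * (u₂ / (e₀ : ℂ)))) = R₁ := ⟨_, rfl⟩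
  obtain ⟨R₀, hR₀⟩ : ∃ R₀ : ℂ, (∑ i ∈ Finset.range (e₀ - 1), A 0 i / a₀ * σ ^ (e₀ - 2 - i) *
    exp ((((i : ℕ) : ℂ) + 1) * (u₂ / (e₀ : ℂ)))) = R₀ := ⟨_, rfl⟩
  have hW1 : S * exp (u₂ / (e₀ : ℂ)) * ∑ i ∈ Finset.range e₁, A 1 i * (S * exp (u₂ / (e₀ : ℂ))) ^ i =
      S ^ e₁ * R₁ := by
    rw [← hR₁, Finset.mul_sum, Finset.mul_sum]
    refine Finset.sum_congr rfl fun i hi => ?_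
    have hi' : i < e₁ := Finset.mem_range.1 hi
    rw [show S * exp (u₂ / (e₀ : ℂ)) * (A 1 i * (S * exp (u₂ / (e₀ : ℂ))) ^ i) =
      A 1 i * (S * exp (u₂ / (e₀ : ℂ))) ^ (i + 1) by ring, hEpow i,
      pow_succ_eq_pow_mul_inv_pow hSσ hi']
    ring
  have htop : (((e₀ - 1 : ℕ) : ℂ) + 1) = (e₀ : ℂ) := by
    rw [Nat.cast_sub he₀]; push_cast; ring
  have hW0 : S * exp (u₂ / (e₀ : ℂ)) * ∑ i ∈ Finset.range e₀, A 0 i * (S * exp (u₂ / (e₀ : ℂ))) ^ i =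
      a₀ * S ^ e₀ * (exp u₂ + σ * R₀) := by
    rw [Finset.mul_sum, show Finset.range e₀ = Finset.range (e₀ - 1 + 1) by
      rw [Nat.sub_add_cancel he₀], Finset.sum_range_succ]
    have htop' : S * exp (u₂ / (e₀ : ℂ)) * (A 0 (e₀ - 1) * (S * exp (u₂ / (e₀ : ℂ))) ^ (e₀ - 1)) =
        a₀ * S ^ e₀ * exp u₂ := by
      rw [show S * exp (u₂ / (e₀ : ℂ)) * (A 0 (e₀ - 1) * (S * exp (u₂ / (e₀ : ℂ))) ^ (e₀ - 1)) =
        A 0 (e₀ - 1) * (S * exp (u₂ / (e₀ : ℂ))) ^ (e₀ - 1 + 1) by ring, hEpow, Nat.sub_add_cancel he₀,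
        ← ha₀def, htop, mul_div_cancel₀ _ heC]
      ring
    have hrest : ∑ i ∈ Finset.range (e₀ - 1), S * exp (u₂ / (e₀ : ℂ)) *
        (A 0 i * (S * exp (u₂ / (e₀ : ℂ))) ^ i) = a₀ * S ^ e₀ * (σ * R₀) := by
      rw [← hR₀, Finset.mul_sum, Finset.mul_sum]
      refine Finset.sum_congr rfl fun i hi => ?_
      have hi' : i < e₀ - 1 := Finset.mem_range.1 hi
      rw [show S * exp (u₂ / (e₀ : ℂ)) * (A 0 i * (S * exp (u₂ / (e₀ : ℂ))) ^ i) =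
        A 0 i * (S * exp (u₂ / (e₀ : ℂ))) ^ (i + 1) by ring, hEpow i,
        pow_succ_eq_pow_mul_inv_pow hSσ (show i < e₀ by omega),
        show e₀ - 1 - i = (e₀ - 2 - i) + 1 by omega, pow_succ]
      field_simp
    rw [htop', hrest]
    ring
  -- the rescaled equations for this `m`
  have hp1 : (pr m).1 = σ := by simp only [hpr]; rw [hτ, ← hσ', neg_div]
  have hp2 : (pr m).2.1 = (2 * Real.pi * I * (K m : ℂ))⁻¹ := by simp only [hpr]
  have hp3 : (pr m).2.2.1 = (2 * Real.pi * I * (K m : ℂ))⁻¹ * (τ / (e₀ : ℂ) - (r₁ : ℂ) * Λ - c) := by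
    simp only [hpr]; rw [hτ, hΛ]
  have hp4 : (pr m).2.2.2.1 = (r₀ : ℂ) * (2 * Real.pi * I * (K m : ℂ))⁻¹ *
      exp ((-(2 * Real.pi * I * (K m : ℂ)) + τ / (e₀ : ℂ) - (r₁ : ℂ) * Λ - c) / (r₀ : ℂ)) := by
    simp only [hpr]; rw [hτ, hΛ]
  have hp5 : (pr m).2.2.2.2.1 = (2 * Real.pi * I * (m : ℂ))⁻¹ := by simp only [hpr]
  have hp6 : (pr m).2.2.2.2.2.1 = (2 * Real.pi * I * (m : ℂ))⁻¹ * Λ := by simp only [hpr]; rw [hΛ]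
  have hp7 : (pr m).2.2.2.2.2.2 = (2 * Real.pi * I * (m : ℂ))⁻¹ * S ^ e₁ := by
    simp only [hpr]; rw [hτ, hSe₁]
  have heq := hm
  simp only [hf, Prod.mk_eq_zero] at heq
  rw [hp1, hp2, hp3, hp4, hp5, hp6, hp7, hu₁, hu₂, hR₁, hR₀] at heq
  obtain ⟨hq1, hq2⟩ := heq
  have hμK : (2 * Real.pi * I * (K m : ℂ)) * (2 * Real.pi * I * (K m : ℂ))⁻¹ = 1 :=
    mul_inv_cancel₀ hKC
  have hμm : (2 * Real.pi * I * (m : ℂ)) * (2 * Real.pi * I * (m : ℂ))⁻¹ = 1 :=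
    mul_inv_cancel₀ h2πim
  -- coordinates of the solution
  have hx1 : x m 1 = Λ + 2 * Real.pi * I * (m : ℂ) + u₁ := by
    simp only [hx, Matrix.cons_val_one, Matrix.cons_val_zero]
    rw [hΛ, hu₁]
  have hx0 : (r₀ : ℂ) * x m 0 = -(2 * Real.pi * I * (K m : ℂ)) + τ / (e₀ : ℂ) - (r₁ : ℂ) * Λ - c +
      (u₂ / (e₀ : ℂ) - (r₁ : ℂ) * u₁) := by
    simp only [hx, Matrix.cons_val_zero]
    rw [hτ, hΛ, hu₁, hu₂, mul_div_cancel₀ _ hr₀C, hKkq m]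
    ring
  obtain ⟨D, hD⟩ : ∃ D : ℂ, exp ((u₂ / (e₀ : ℂ) - (r₁ : ℂ) * u₁) / (r₀ : ℂ)) = D := ⟨_, rfl⟩
  obtain ⟨X0c, hX0c⟩ : ∃ X : ℂ,
    exp ((-(2 * Real.pi * I * (K m : ℂ)) + τ / (e₀ : ℂ) - (r₁ : ℂ) * Λ - c) / (r₀ : ℂ)) = X := ⟨_, rfl⟩
  have hex0 : exp (x m 0) = X0c * D := by
    rw [← hX0c, ← hD, ← Complex.exp_add]
    congr 1
    rw [← add_div, eq_div_iff hr₀C]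
    linear_combination hx0
  have hex1 : exp (x m 1) = 2 * Real.pi * I * (m : ℂ) * exp u₁ := by
    rw [hx1, Complex.exp_add, Complex.exp_add, ← hΛ, Complex.exp_log h2πim,
      show 2 * Real.pi * I * (m : ℂ) = ((m : ℤ) : ℂ) * (2 * Real.pi * I) by push_cast; ring,
      Complex.exp_int_mul_two_pi_mul_I, mul_one]
  have hexpℓ : exp (∑ i, ((![r₀, r₁] : Fin 2 → ℝ) i : ℂ) * x m i + c) = S * exp (u₂ / (e₀ : ℂ)) := by
    rw [hℓ, hτ, hu₂, hexpt]
  rw [hD, hX0c] at hq1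
  constructor
  · rw [hexpℓ, hW0, hex0]
    have hgoal : (r₀ : ℂ) * (X0c * D) = (r₀ : ℂ) * (x m 0 + a₀ * S ^ e₀ * (exp u₂ + σ * R₀)) := by
      linear_combination (-(2 * Real.pi * I * (K m : ℂ))) * hq1 + (-(exp u₂ + σ * R₀)) * hK2 -
        hx0 + ((τ / (e₀ : ℂ) - (r₁ : ℂ) * Λ - c) + (u₂ / (e₀ : ℂ) - (r₁ : ℂ) * u₁) -
          (r₀ : ℂ) * X0c * D) * hμK
    exact mul_left_cancel₀ hr₀C hgoal
  · rw [hexpℓ, hW1, hex1, hx1]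
    linear_combination (2 * Real.pi * I * (m : ℂ)) * hq2 + (Λ + u₁ + S ^ e₁ * R₁) * hμm

end Cancelling

end Summit.Schanuel.Schanuel.Theorems

end
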